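import Summits.AtomisticToContinuum.BoseEinsteinCondensation.Theorems.InfraredMinimumUncertainty.Negative.MinimalityLoadBearing

/-!
# Negative lemmas for crux `InfraredMinimumUncertainty` (stmt-AtomisticToContinuum-11784) — VII:
# Fisher test functional of an affine field; second moments of the density mode on the density wave

Supports (does not close) stmt-AtomisticToContinuum-11784 (route `BECConjugateDomination`; picked
line `fisher-gaussian-density-mode`).  Importable form of §F (first half) of the cdisprove seat's
standing file `Cruxes/InfraredMinimumUncertainty/Disproof.lean`; consumed by
`FisherGaussianityLoadBearing.lean`.

* `affineField` (`φ_{λ,μ}(z) = −λ(Re z − μ)`), `contDiff_affineField`, `hasFDerivAt_affineField`,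
  `planarDiv_affineField` (`div φ_{λ,μ} = −λ`), `fisherTest_affineField`:
  **`J(φ_{λ,μ}) = 2λ − λ² ∫ (Re Z_m − μ)² |Ψ|²`** for every admissible `Ψ`;
* on the free density wave of `FreeDensityWave.lean`: `integral_two_mul_norm_sq_waveFun` (two
  distinguished particles under the product state, Fubini), `waveMean` (`μ_N = N·2ε/(1+2ε²)`),
  `integral_re_densityMode_waveFun` (`E Re Z_{e₀} = μ_N`), `integral_re_densityMode_sq_waveFun_le`
  (`E (Re Z_{e₀})² ≤ N + μ_N²`), `variance_re_densityMode_waveState_le` (**`Var Re Z_{e₀} ≤ N`**),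
  `fisherTest_waveState_ge` (**`J(φ_{1/N,μ_N}) ≥ 1/N`**).
-/


noncomputable section

open MeasureTheory Filter Set
open scoped ENNReal NNReal Topology ComplexConjugate BigOperators

namespace Summit.AtomisticToContinuum.BoseEinsteinCondensation.Theorems.InfraredMinimumUncertainty.Negative

open Literature.MathematicalPhysics.QuantumManyBody.BoseGas
open Summit.AtomisticToContinuum.BoseEinsteinCondensation.Theses.BECConjugateDomination
open Summit.AtomisticToContinuum.BoseEinsteinCondensation.Cruxes.InfraredMinimumUncertainty.FisherGaussianDensityMode
open Summit.AtomisticToContinuum.BoseEinsteinCondensation.Theorems.GaussianDominationCan.Negative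
  (prodFun contDiff_prodFun)
open Summit.AtomisticToContinuum.BoseEinsteinCondensation.Theorems.StaticResponseBound.Negative
  (arg re_cellWave isRepulsiveFiniteRange_zero integral_norm_sq_eq_one)
open Summit.AtomisticToContinuum.BoseEinsteinCondensation.Theorems.CorrectorClosure.Negative
  (e0 e0_ne_zero sideLength_succ_pos)

/-! ### The affine real test field and its Fisher test functional -/

section Affine

variable {n : ℕ} {L : ℝ}

/-- The affine real test field `φ_{λ,μ}(z) = −λ(Re z − μ)` on `ℂ ≅ ℝ²`. -/
def affineField (lam μ : ℝ) (z : ℂ) : ℂ := ((-(lam * (z.re - μ)) : ℝ) : ℂ)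

/-- `φ_{λ,μ}` is `C¹` (indeed affine). [folklore] -/
theorem contDiff_affineField (lam μ : ℝ) : ContDiff ℝ 1 (affineField lam μ) :=
  Complex.ofRealCLM.contDiff.comp
    ((contDiff_const.mul (Complex.reCLM.contDiff.sub contDiff_const)).neg)

/-- The derivative of `φ_{λ,μ}`: `dφ = ofReal ∘ (−λ Re)`. [folklore] -/
theorem hasFDerivAt_affineField (lam μ : ℝ) (z : ℂ) :
    HasFDerivAt (affineField lam μ) (Complex.ofRealCLM.comp (-(lam • Complex.reCLM))) z := by
  have h1 : HasFDerivAt (fun w : ℂ => -(lam * (w.re - μ))) (-(lam • Complex.reCLM)) z := by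
    have h := ((Complex.reCLM.hasFDerivAt (x := z)).sub_const μ).const_mul lam
    exact h.neg
  exact Complex.ofRealCLM.hasFDerivAt.comp z h1

/-- `div φ_{λ,μ} = −λ`. [folklore] -/
theorem planarDiv_affineField (lam μ : ℝ) (z : ℂ) : planarDiv (affineField lam μ) z = -lam := by
  unfold planarDiv
  rw [(hasFDerivAt_affineField lam μ z).fderiv]
  simp

/-- **The Fisher test functional at the affine real field**:
`J(φ_{λ,μ}) = 2λ − λ² ∫ (Re Z_m − μ)² |Ψ|²`. [folklore] -/
theorem fisherTest_affineField (Ψ : PeriodicTrialState (n + 1) L) (m : Fin 3 → ℤ) (lam μ : ℝ) :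
    fisherTest n L Ψ m (affineField lam μ) =
      2 * lam - lam ^ 2 * ∫ X in cellN (n + 1) L,
        ((densityMode (n + 1) L m X).re - μ) ^ 2 * ‖Ψ.ψ X‖ ^ 2 := by
  unfold fisherTest
  simp only [planarDiv_affineField]
  have h1 : ∫ X in cellN (n + 1) L, -lam * ‖Ψ.ψ X‖ ^ 2 = -lam := by
    rw [integral_const_mul, integral_norm_sq_eq_one, mul_one]
  have h2 : ∀ X : Config (n + 1), ‖affineField lam μ (densityMode (n + 1) L m X)‖ ^ 2 * ‖Ψ.ψ X‖ ^ 2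
      = lam ^ 2 * (((densityMode (n + 1) L m X).re - μ) ^ 2 * ‖Ψ.ψ X‖ ^ 2) := by
    intro X
    rw [affineField, Complex.norm_real, Real.norm_eq_abs, sq_abs]
    ring
  simp_rw [h2]
  rw [h1, integral_const_mul]
  ring

end Affine

/-! ### Second moments of `Re Z` on the density wave: two-index Fubini -/

section Moments

variable {L : ℝ} {ε : ℝ} {n : ℕ}

/-- **Two distinguished particles under the product state**: for `j ≠ l` and continuous `f`,
`∫ f(xⱼ) f(x_l) |Ψ|² = (∫_cell f φ²)²`. [folklore] -/
theorem integral_two_mul_norm_sq_waveFun (hL : 0 < L) (hε : |ε| < 1 / 2) {j l : Fin (n + 1)}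
    (hjl : j ≠ l) (f : Space → ℝ) :
    ∫ X in cellN (n + 1) L, f (X j) * f (X l) * ‖waveFun n L ε X‖ ^ 2 =
      (∫ x in cell L, f x * waveFactor L ε x ^ 2) ^ 2 := by
  classical
  simp_rw [norm_sq_waveFun hL hε]
  set p : Fin (n + 1) → Prop := fun i => i = j ∨ i = l with hp
  set F : Fin (n + 1) → Space → ℝ := fun i x =>
    if p i then f x * waveFactor L ε x ^ 2 else waveFactor L ε x ^ 2 with hF
  have hfilt : Finset.univ.filter p = {j, l} := by
    ext i; simp [hp]
  have hpt : ∀ X : Config (n + 1), f (X j) * f (X l) * ∏ i, waveFactor L ε (X i) ^ 2 =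
      ∏ i, F i (X i) := by
    intro X
    simp only [hF]
    rw [Finset.prod_ite, hfilt, Finset.prod_pair hjl,
      ← Finset.prod_filter_mul_prod_filter_not Finset.univ p (fun i => waveFactor L ε (X i) ^ 2),
      hfilt, Finset.prod_pair hjl]
    ring
  simp_rw [hpt]
  rw [integral_cellN_prod_real F]
  have hFi : ∀ i, ∫ x in cell L, F i x =
      if p i then ∫ x in cell L, f x * waveFactor L ε x ^ 2 else 1 := by
    intro i
    by_cases hi : p i
    · simp only [hF, if_pos hi]
    · simp only [hF, if_neg hi]
      exact integral_cell_waveFactor_sq hL ε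
  simp_rw [hFi]
  rw [Finset.prod_ite, hfilt, Finset.prod_const, Finset.card_pair hjl, Finset.prod_const_one,
    mul_one]

/-- The mean of `Re Z_{e₀}` on the density wave: `μ_N = N · 2ε/(1 + 2ε²)`. -/
def waveMean (n : ℕ) (ε : ℝ) : ℝ := ((n : ℝ) + 1) * (2 * ε / (1 + 2 * ε ^ 2))

/-- `∫ Re Z_{e₀} |Ψ|² = μ_N`. [folklore] -/
theorem integral_re_densityMode_waveFun (hL : 0 < L) (hε : |ε| < 1 / 2) :
    ∫ X in cellN (n + 1) L, (densityMode (n + 1) L e0 X).re * ‖waveFun n L ε X‖ ^ 2 =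
      waveMean n ε := by
  have hre : ∀ X, (densityMode (n + 1) L e0 X).re = ∑ j, Real.cos (arg L e0 (X j)) := by
    intro X; simp [densityMode, Complex.re_sum, re_cellWave]
  simp_rw [hre, Finset.sum_mul]
  have hw : Continuous fun X : Config (n + 1) => ‖waveFun n L ε X‖ ^ 2 :=
    ((contDiff_prodFun fun _ => contDiff_waveFactorC L ε).continuous.norm).pow 2
  rw [integral_finsetSum _ fun j _ => ?_]
  · simp only [integral_cos_mul_norm_sq_waveFun hL hε, Finset.sum_const, Finset.card_univ,
      Fintype.card_fin, nsmul_eq_mul, Nat.cast_add, Nat.cast_one, waveMean]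
  · exact integrableOn_cellN (Continuous.mul (by fun_prop) hw) L

/-- **Second moment bound**: `∫ (Re Z_{e₀})² |Ψ|² ≤ N + μ_N²` on the density wave (diagonal
terms `≤ 1`, off-diagonal terms `= (2ε/(1+2ε²))²` by the two-index Fubini). [folklore] -/
theorem integral_re_densityMode_sq_waveFun_le (hL : 0 < L) (hε : |ε| < 1 / 2) :
    ∫ X in cellN (n + 1) L, (densityMode (n + 1) L e0 X).re ^ 2 * ‖waveFun n L ε X‖ ^ 2 ≤
      ((n : ℝ) + 1) + waveMean n ε ^ 2 := by
  classical
  set a : ℝ := 2 * ε / (1 + 2 * ε ^ 2) with ha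
  have hre : ∀ X, (densityMode (n + 1) L e0 X).re = ∑ j, Real.cos (arg L e0 (X j)) := by
    intro X; simp [densityMode, Complex.re_sum, re_cellWave]
  have hw : Continuous fun X : Config (n + 1) => ‖waveFun n L ε X‖ ^ 2 :=
    ((contDiff_prodFun fun _ => contDiff_waveFactorC L ε).continuous.norm).pow 2
  have hexp : ∀ X : Config (n + 1), (densityMode (n + 1) L e0 X).re ^ 2 * ‖waveFun n L ε X‖ ^ 2 =
      ∑ j, ∑ l, Real.cos (arg L e0 (X j)) * Real.cos (arg L e0 (X l)) * ‖waveFun n L ε X‖ ^ 2 := by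
    intro X
    rw [hre, sq, Finset.sum_mul_sum, Finset.sum_mul]
    refine Finset.sum_congr rfl fun j _ => ?_
    rw [Finset.sum_mul]
  simp_rw [hexp]
  have hint : ∀ j l : Fin (n + 1), Integrable (fun X : Config (n + 1) =>
      Real.cos (arg L e0 (X j)) * Real.cos (arg L e0 (X l)) * ‖waveFun n L ε X‖ ^ 2)
      (volume.restrict (cellN (n + 1) L)) := fun j l =>
    integrableOn_cellN (Continuous.mul (by fun_prop) hw) L
  rw [integral_finsetSum _ fun j _ => integrable_finsetSum _ fun l _ => hint j l]
  rw [Finset.sum_congr rfl fun j _ => integral_finsetSum _ fun l _ => hint j l]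
  -- termwise bounds
  have hterm : ∀ j l : Fin (n + 1), ∫ X in cellN (n + 1) L,
      Real.cos (arg L e0 (X j)) * Real.cos (arg L e0 (X l)) * ‖waveFun n L ε X‖ ^ 2 ≤
      (if j = l then 1 else 0) + a ^ 2 := by
    intro j l
    by_cases hjl : j = l
    · subst hjl
      rw [if_pos rfl]
      have h1 : ∫ X in cellN (n + 1) L,
          Real.cos (arg L e0 (X j)) * Real.cos (arg L e0 (X j)) * ‖waveFun n L ε X‖ ^ 2 ≤
          ∫ X in cellN (n + 1) L, ‖waveFun n L ε X‖ ^ 2 := by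
        refine integral_mono (hint j j) (integrableOn_cellN hw L) fun X => ?_
        have hc := Real.abs_cos_le_one (arg L e0 (X j))
        have : Real.cos (arg L e0 (X j)) * Real.cos (arg L e0 (X j)) ≤ 1 := by
          nlinarith [abs_le.mp hc]
        simpa using mul_le_mul_of_nonneg_right this (sq_nonneg ‖waveFun n L ε X‖)
      have h2 : ∫ X in cellN (n + 1) L, ‖waveFun n L ε X‖ ^ 2 = 1 :=
        integral_norm_sq_eq_one (waveState n hL ε)
      nlinarith [sq_nonneg a]
    · have h2 := integral_two_mul_norm_sq_waveFun hL hε hjl (fun x => Real.cos (arg L e0 x))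
      rw [if_neg hjl, zero_add, h2, integral_cell_cos_mul_waveFactor_sq hL]
  calc ∑ j, ∑ l, ∫ X in cellN (n + 1) L,
        Real.cos (arg L e0 (X j)) * Real.cos (arg L e0 (X l)) * ‖waveFun n L ε X‖ ^ 2
      ≤ ∑ j : Fin (n + 1), ∑ l : Fin (n + 1), ((if j = l then (1 : ℝ) else 0) + a ^ 2) :=
        Finset.sum_le_sum fun j _ => Finset.sum_le_sum fun l _ => hterm j l
    _ = ((n : ℝ) + 1) + waveMean n ε ^ 2 := by
        simp only [Finset.sum_add_distrib, Finset.sum_ite_eq, Finset.mem_univ, if_true,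
          Finset.sum_const, Finset.card_univ, Fintype.card_fin, nsmul_eq_mul, waveMean, ← ha]
        push_cast
        ring

/-- **Variance bound**: `∫ (Re Z_{e₀} − μ_N)² |Ψ|² ≤ N` on the density wave. [folklore] -/
theorem variance_re_densityMode_waveState_le (hL : 0 < L) (hε : |ε| < 1 / 2) :
    ∫ X in cellN (n + 1) L, ((densityMode (n + 1) L e0 X).re - waveMean n ε) ^ 2 *
      ‖waveFun n L ε X‖ ^ 2 ≤ (n : ℝ) + 1 := by
  have hw : Continuous fun X : Config (n + 1) => ‖waveFun n L ε X‖ ^ 2 :=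
    ((contDiff_prodFun fun _ => contDiff_waveFactorC L ε).continuous.norm).pow 2
  have hZ : Continuous fun X : Config (n + 1) => (densityMode (n + 1) L e0 X).re := by
    unfold densityMode; fun_prop
  have i2 : Integrable (fun X => (densityMode (n + 1) L e0 X).re ^ 2 * ‖waveFun n L ε X‖ ^ 2)
      (volume.restrict (cellN (n + 1) L)) := integrableOn_cellN ((hZ.pow 2).mul hw) L
  have i1 : Integrable (fun X => (densityMode (n + 1) L e0 X).re * ‖waveFun n L ε X‖ ^ 2)
      (volume.restrict (cellN (n + 1) L)) := integrableOn_cellN (hZ.mul hw) L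
  have i0 : Integrable (fun X => ‖waveFun n L ε X‖ ^ 2) (volume.restrict (cellN (n + 1) L)) :=
    integrableOn_cellN hw L
  have hexp : ∀ X : Config (n + 1), ((densityMode (n + 1) L e0 X).re - waveMean n ε) ^ 2 *
      ‖waveFun n L ε X‖ ^ 2 = (densityMode (n + 1) L e0 X).re ^ 2 * ‖waveFun n L ε X‖ ^ 2 -
        2 * waveMean n ε * ((densityMode (n + 1) L e0 X).re * ‖waveFun n L ε X‖ ^ 2) +
          waveMean n ε ^ 2 * ‖waveFun n L ε X‖ ^ 2 := fun X => by ring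
  simp_rw [hexp]
  have iA : Integrable (fun X => (densityMode (n + 1) L e0 X).re ^ 2 * ‖waveFun n L ε X‖ ^ 2 -
      2 * waveMean n ε * ((densityMode (n + 1) L e0 X).re * ‖waveFun n L ε X‖ ^ 2))
      (volume.restrict (cellN (n + 1) L)) := i2.sub (i1.const_mul _)
  have hn1 : ∫ X in cellN (n + 1) L, ‖waveFun n L ε X‖ ^ 2 = 1 :=
    integral_norm_sq_eq_one (waveState n hL ε)
  rw [integral_add iA (i0.const_mul _), integral_sub i2 (i1.const_mul _), integral_const_mul,
    integral_const_mul, integral_re_densityMode_waveFun hL hε, hn1]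
  have h2 := integral_re_densityMode_sq_waveFun_le (n := n) hL hε
  nlinarith [h2]

/-- **The Fisher test functional of the density wave at `φ_{1/N, μ_N}` is at least `1/N`.** [folklore] -/
theorem fisherTest_waveState_ge (hL : 0 < L) (hε : |ε| < 1 / 2) :
    ((n : ℝ) + 1)⁻¹ ≤
      fisherTest n L (waveState n hL ε) e0 (affineField ((n : ℝ) + 1)⁻¹ (waveMean n ε)) := by
  rw [fisherTest_affineField]
  simp only [waveState_ψ]
  have hN : (0 : ℝ) < (n : ℝ) + 1 := by positivity
  have hV := variance_re_densityMode_waveState_le (n := n) hL hε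
  have hV0 : 0 ≤ ∫ X in cellN (n + 1) L, ((densityMode (n + 1) L e0 X).re - waveMean n ε) ^ 2 *
      ‖waveFun n L ε X‖ ^ 2 := integral_nonneg fun X => by positivity
  have key : ((n : ℝ) + 1)⁻¹ ^ 2 * ∫ X in cellN (n + 1) L,
      ((densityMode (n + 1) L e0 X).re - waveMean n ε) ^ 2 * ‖waveFun n L ε X‖ ^ 2 ≤
      ((n : ℝ) + 1)⁻¹ := by
    calc ((n : ℝ) + 1)⁻¹ ^ 2 * ∫ X in cellN (n + 1) L,
          ((densityMode (n + 1) L e0 X).re - waveMean n ε) ^ 2 * ‖waveFun n L ε X‖ ^ 2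
        ≤ ((n : ℝ) + 1)⁻¹ ^ 2 * ((n : ℝ) + 1) := mul_le_mul_of_nonneg_left hV (by positivity)
      _ = ((n : ℝ) + 1)⁻¹ := by field_simp
  linarith

end Moments


end Summit.AtomisticToContinuum.BoseEinsteinCondensation.Theorems.InfraredMinimumUncertainty.Negative

end
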